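/-
Origin: expansion seat `prover-pub-hodgecm-mc-carch-1-g4-0`, handover #CA29 2026-08-20T07:50Z md5 a86ce34e99f9 (172 l., 12 decls; NEW additive leaf; imports installed #CA3 Model.ArchKTypeOfLines + sinst #1208 Model.ArchLineSlotTypeCont + #CA28 (this kit); RUN 44; INSTALL after #CA28; cert certs/ax-ArchKTypeOfLambda-a86ce34e99f9.log: rc 0 / 32 s / 0 warnings / 12/12 trio) (`HOME/mc/pub-hodgecm-mc-carch-1/pkg44/HodgeCM/Model/ArchKTypeOfLambda.lean`, md5 a86ce34e99f9, 172 lines);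
landed by the second packager p2 gen 4 (p2-g4) in gate run 44 as `HodgeCM/Model/ArchKTypeOfLambda.lean` (verbatim).
-/
/-
Copyright (c) 2026. Released under Apache 2.0 license as described in the file LICENSE.
Cell pub-hodgecm, MODEL layer (construction prover mc-carch-1, gen 4), BINDER-OWNERS row 12 `C`, junction (C-Λ), item (Λ-v₁):
the see-saw factor of the line-0 scalar on `Stab(x₀)` is `(det A · d)^ℓ` for ONE integer `ℓ`.
-/
import Summits.HodgeConjecture.HodgeCM.Model.ArchKTypeOfLines
import Summits.HodgeConjecture.HodgeCM.Model.ArchU21Characters_2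
import Summits.HodgeConjecture.HodgeCM.Model.ArchLineSlotTypeCont_2

/-!
# (C-Λ), item (Λ-v₁): the see-saw discrepancy of line 0 is a power of `det` on `K = Stab(x₀) ⊂ U(2,1)`

#CA3's line-0 scalar on `U(2,1)` is `lineScalar_zero … η₀ = (η₀-part) · λ` with `λ := lambdaChar V S hGR hGR₀ hGR₁ : U21 →* ℂˣ`,
`λ u = cmLineChar₀ … ((archSectionFrameOf V u)^𝔸, 1)` — the V-factor `λ_V′ = charV₃₄` of the see-saw discrepancy of the three CHOSEN
splittings ([GelbartRogawski1991, Prop. 3.1.1]: bare existence), pulled back along the `ι₁`-section.  Nothing about `λ` can be chosen; but: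

* § 1 `lambdaChar`, `lineScalar_zero_eq_mul_lambdaChar` (definitional split of #CA3's scalar);
* § 2 `continuous_lambdaChar_D₀` — `z ↦ λ (diag(z,1,1))` is continuous on the circle, from SIGN FACTS ONLY (`frameD_sign_ι₁'`, `frameD_sign_of_ne`,
  the plane's definiteness `h₁W` at `ι₁`): sinst #1208 `continuous_cmLineChar₀_of_signs` ∘ K-1 `continuous_cmFrameEquiv` ∘ `continuous_archSectionU21CM`
  ∘ #CA28 `continuous_D₀_circle` (bridge #CA2 `cmFrameEquiv_archSectionU21CM`);
* § 3 **`exists_lambdaExponent`**: `∃ ℓ : ℤ, ∀ k : K21, λ (blockU k) = (det (matA k) · sclD k) ^ ℓ` — #CA28 `U21Char.exists_zpow_of_continuous`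
  (every abelian character of `U(2,1)` factors through `det` on `K`; [BröckerTomDieck1985, II (8.1)] for the circle); the exponent OF RECORD
  **`lambdaExponent V S hGR hGR₀ hGR₁ h₁W : ℤ`** (one `Classical.choose`) with `lambdaChar_blockU` / `lambdaChar_stabilizer`;
* § 4 **`lineScalar_zero_stabilizer`**: on `u ∈ Stab(x₀)`, `lineScalar_zero … η₀ u = η₀ ((archSectionFrameOf V u)^𝔸, 1) · (det A · d)^ℓ`, and the
  socket **`hχ_zero_of_archType`**: if the η-part is `(det A · d)^m` on `Stab(x₀)` and `m + ℓ + e_P = 0`, `m + ℓ + e_Q = −1`, then the `hχ₀` INPUT of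
  the row-12 term (#CA17/#CA19/#CA25, shape of #CA11 `lineScalar_identity_of_exponents`) HOLDS — (χ)₀ is a READ-OFF condition on the type of the
  η-part at `w(ι₁)` (at the R1 pin: of `χV · ν₁⁻¹`), no longer on an opaque character.

0 records, 0 `def … : Prop`, nothing cited as a hypothesis; the only non-kernel input is continuity from sign facts.
-/

set_option autoImplicit false

noncomputable section

open NumberField NumberField.mixedEmbedding IsDedekindDomain
open scoped Matrix Classical
open Literature.Geometry.ComplexHyperbolic Literature.Geometry.ComplexHyperbolic.BallModel
open Literature.NumberTheory.Automorphic Literature.NumberTheory.Automorphic.U21 Literature.NumberTheory.Weil1964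
open Literature.NumberTheory.GelbartRogawski1991 Literature.NumberTheory.GelbartRogawski1991.UnitaryDualPair
open HodgeCM.Adelic HodgeCM.PerL34 HodgeCM.Model.HypCensus HodgeCM.Model.U21Char

namespace HodgeCM.Model

namespace ArchSideTerm

variable {L : CMField} {ι₁ : L →+* ℂ} (V : HermSpace3 L ι₁) (S : StubTree.SeesawDatum L)

variable
  (hGR : (cmSplittingDatum (L : Type) finProdFinEquiv (frameD V) (frameD_real V) (frameD_ne V) (dW S) (dW_real S) (dW_ne S)).CompatibleSplitting)
  (hGR₀ : (cmSplittingDatum (L : Type) (e₁) (frameD V) (frameD_real V) (frameD_ne V) (lineVec (L : Type) (dW S 0))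
    (fun _ => dW_real S 0) (fun _ => dW_ne S 0)).CompatibleSplitting)
  (hGR₁ : (cmSplittingDatum (L : Type) (e₁) (frameD V) (frameD_real V) (frameD_ne V) (lineVec (L : Type) (dW S 1))
    (fun _ => dW_real S 1) (fun _ => dW_ne S 1)).CompatibleSplitting)
  (η₀ : CMAdelic (L : Type) (frameD V) × CMAdelicOne (L : Type) →* ℂˣ)

/-! ## § 1 The see-saw factor of the line-0 scalar -/

/-- **`λ : U(2,1) →* ℂˣ`, `u ↦ χ₀((archSectionFrameOf V u)^𝔸, 1)`** — the see-saw discrepancy `cmLineChar₀` of the chosen splittings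
(`= (charV₃₄ ∘ fst)·(char₃ ∘ snd)`, so at `snd = 1` the factor `λ_V′ = charV₃₄`) pulled back along the `ι₁`-section of record. -/
def lambdaChar : U21 →* ℂˣ :=
  (cmLineChar₀ (L : Type) finProdFinEquiv e₁ (frameD V) (frameD_real V) (frameD_ne V) (dW S) (dW_real S) (dW_ne S) hGR hGR₀ hGR₁).comp
    (MonoidHom.prod ((UnitaryGroup.archToAdelic (↥(maximalRealSubfield L)) L (IsCMField.complexConj L) 3
      (Matrix.diagonal (frameD V))).comp (archSectionFrameOf V)) 1)

/-- (Ported verbatim from the HodgeCMPerL package; no docstring in the source.) -/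
theorem lambdaChar_apply (u : U21) :
    lambdaChar V S hGR hGR₀ hGR₁ u =
      cmLineChar₀ (L : Type) finProdFinEquiv e₁ (frameD V) (frameD_real V) (frameD_ne V) (dW S) (dW_real S) (dW_ne S) hGR hGR₀ hGR₁
        (UnitaryGroup.archToAdelic (↥(maximalRealSubfield L)) L (IsCMField.complexConj L) 3 (Matrix.diagonal (frameD V))
          (archSectionFrameOf V u), 1) :=
  rfl

/-- #CA3's line-0 scalar SPLITS as `(η₀-part) · λ` (definitional). -/
theorem lineScalar_zero_eq_mul_lambdaChar :
    lineScalar_zero V S hGR hGR₀ hGR₁ η₀ =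
      (η₀.comp (MonoidHom.prod ((UnitaryGroup.archToAdelic (↥(maximalRealSubfield L)) L (IsCMField.complexConj L) 3
        (Matrix.diagonal (frameD V))).comp (archSectionFrameOf V)) 1)) * lambdaChar V S hGR hGR₀ hGR₁ :=
  rfl

/-- (Ported verbatim from the HodgeCMPerL package; no docstring in the source.) -/
theorem lineScalar_zero_apply_eq_mul (u : U21) :
    lineScalar_zero V S hGR hGR₀ hGR₁ η₀ u =
      η₀ (UnitaryGroup.archToAdelic (↥(maximalRealSubfield L)) L (IsCMField.complexConj L) 3 (Matrix.diagonal (frameD V))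
          (archSectionFrameOf V u), 1) * lambdaChar V S hGR hGR₀ hGR₁ u :=
  rfl

/-! ## § 2 Continuity on the circle `z ↦ diag(z, 1, 1)` from sign facts -/

variable (h₁W : (∀ j, 0 < (ι₁ (dW S j)).re) ∨ ∀ j, (ι₁ (dW S j)).re < 0)

include h₁W in
/-- `u ↦ (λ u : ℂ)` is continuous on all of `U(2,1)`. -/
theorem continuous_lambdaChar : Continuous fun u : U21 => ((lambdaChar V S hGR hGR₀ hGR₁ u : ℂˣ) : ℂ) := by
  have hc := continuous_cmLineChar₀_of_signs (L : Type) finProdFinEquiv e₁ (frameD V) (frameD_real V) (frameD_ne V) (dW S)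
    (dW_real S) (dW_ne S) hGR hGR₀ hGR₁ ι₁ (frameD_sign_ι₁' V) h₁W (frameD_sign_of_ne V)
  have he : (fun u : U21 => ((lambdaChar V S hGR hGR₀ hGR₁ u : ℂˣ) : ℂ)) =
      (fun p => ((cmLineChar₀ (L : Type) finProdFinEquiv e₁ (frameD V) (frameD_real V) (frameD_ne V) (dW S) (dW_real S) (dW_ne S)
        hGR hGR₀ hGR₁ p : ℂˣ) : ℂ)) ∘
      fun u : U21 => (cmFrameEquiv (L : Type) (frameG V) V.Hm (frameD V) (frame_congr V)
        (UnitaryGroup.archSectionU21CM (L : Type) ι₁ V.Hm V.sylvesterFrame (sylvesterFrame_J V) u), (1 : CMAdelic (L : Type) (lineVec (L : Type) (dW S 0)))) := by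
    funext u
    simp only [Function.comp_apply, lambdaChar_apply, cmFrameEquiv_archSectionU21CM]
  rw [he]
  exact hc.comp (((continuous_cmFrameEquiv (L : Type) (frameG V) V.Hm (frameD V) (frame_congr V)).comp
    (UnitaryGroup.continuous_archSectionU21CM (L : Type) ι₁ V.Hm V.sylvesterFrame (sylvesterFrame_J V))).prodMk continuous_const)

include h₁W in
/-- `z ↦ λ (diag(z, 1, 1))` is continuous on the circle. -/
theorem continuous_lambdaChar_D₀ :
    Continuous fun z : Circle => ((lambdaChar V S hGR hGR₀ hGR₁ (D₀ (circleToUnitary z)) : ℂˣ) : ℂ) :=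
  (continuous_lambdaChar V S hGR hGR₀ hGR₁ h₁W).comp continuous_D₀_circle

/-! ## § 3 The exponent `ℓ` of record -/

include h₁W in
/-- **(Λ-v₁)**: the see-saw factor is `(det A · d)^ℓ` on `K = U(2) × U(1)` for ONE integer `ℓ`. -/
theorem exists_lambdaExponent :
    ∃ ℓ : ℤ, ∀ k : K21, ((lambdaChar V S hGR hGR₀ hGR₁ (blockU k) : ℂˣ) : ℂ) = ((matA k).det * sclD k) ^ ℓ :=
  exists_zpow_of_continuous _ (continuous_lambdaChar_D₀ V S hGR hGR₀ hGR₁ h₁W)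

/-- **the exponent OF RECORD** of the see-saw factor at `v₁` (one `Classical.choose`; unique by `CircleChar`, not needed here). -/
def lambdaExponent : ℤ := (exists_lambdaExponent V S hGR hGR₀ hGR₁ h₁W).choose

/-- (Ported verbatim from the HodgeCMPerL package; no docstring in the source.) -/
theorem lambdaChar_blockU (k : K21) :
    ((lambdaChar V S hGR hGR₀ hGR₁ (blockU k) : ℂˣ) : ℂ) = ((matA k).det * sclD k) ^ lambdaExponent V S hGR hGR₀ hGR₁ h₁W :=
  (exists_lambdaExponent V S hGR hGR₀ hGR₁ h₁W).choose_spec k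

/-- the same on `Stab(x₀)` through `stabilizerEquivK21`. -/
theorem lambdaChar_stabilizer (u : MulAction.stabilizer U21 x₀) :
    ((lambdaChar V S hGR hGR₀ hGR₁ (u : U21) : ℂˣ) : ℂ) =
      ((matA (stabilizerEquivK21.symm u)).det * sclD (stabilizerEquivK21.symm u)) ^ lambdaExponent V S hGR hGR₀ hGR₁ h₁W := by
  have hu : (u : U21) = blockU (stabilizerEquivK21.symm u) := by
    rw [← coe_blockK, ← stabilizerEquivK21_apply, MulEquiv.apply_symm_apply]
  rw [hu, lambdaChar_blockU]

/-! ## § 4 The line-0 scalar on `Stab(x₀)` and the (χ)₀ socket -/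

/-- **on `Stab(x₀)`: `lineScalar_zero … η₀ u = η₀((archSectionFrameOf V u)^𝔸, 1) · (det A · d)^ℓ`.** -/
theorem lineScalar_zero_stabilizer (u : MulAction.stabilizer U21 x₀) :
    ((lineScalar_zero V S hGR hGR₀ hGR₁ η₀ (u : U21) : ℂˣ) : ℂ) =
      ((η₀ (UnitaryGroup.archToAdelic (↥(maximalRealSubfield L)) L (IsCMField.complexConj L) 3 (Matrix.diagonal (frameD V))
          (archSectionFrameOf V (u : U21)), 1) : ℂˣ) : ℂ) *
        ((matA (stabilizerEquivK21.symm u)).det * sclD (stabilizerEquivK21.symm u)) ^ lambdaExponent V S hGR hGR₀ hGR₁ h₁W := by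
  rw [lineScalar_zero_apply_eq_mul, Units.val_mul, lambdaChar_stabilizer]

/-- **THE (χ)₀ SOCKET.**  If the η-part of the line-0 scalar is `(det A · d)^m` on `Stab(x₀)` and the types satisfy `m + ℓ + e_P = 0`,
`m + ℓ + e_Q = −1` (consistent iff `e_P − e_Q = 1`, binder-2's pinned difference for a line positive at `v₁`), then the `hχ₀` input of the
row-12 term holds (the text of #CA17/#CA19/#CA25's `hχ₀` at any exponent tuple `ev`). -/
theorem hχ_zero_of_archType {m : ℤ} (ev : Literature.RepresentationTheory.KonnoKonno2007.VacExponents)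
    (hη : ∀ u : MulAction.stabilizer U21 x₀,
      ((η₀ (UnitaryGroup.archToAdelic (↥(maximalRealSubfield L)) L (IsCMField.complexConj L) 3 (Matrix.diagonal (frameD V))
          (archSectionFrameOf V (u : U21)), 1) : ℂˣ) : ℂ) =
        ((matA (stabilizerEquivK21.symm u)).det * sclD (stabilizerEquivK21.symm u)) ^ m)
    (hm : m + lambdaExponent V S hGR hGR₀ hGR₁ h₁W + ev.eP = 0) (hm' : m + lambdaExponent V S hGR hGR₀ hGR₁ h₁W + ev.eQ = -1)
    (u : MulAction.stabilizer U21 x₀) :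
    ((lineScalar_zero V S hGR hGR₀ hGR₁ η₀ (u : U21) : ℂˣ) : ℂ) *
        ((matA (stabilizerEquivK21.symm u)).det ^ ev.eP * sclD (stabilizerEquivK21.symm u) ^ ev.eQ) =
      star (sclD (stabilizerEquivK21.symm u)) := by
  refine lineScalar_identity_of_exponents (χ := lineScalar_zero V S hGR hGR₀ hGR₁ η₀)
    (m := m + lambdaExponent V S hGR hGR₀ hGR₁ h₁W) (m' := m + lambdaExponent V S hGR hGR₀ hGR₁ h₁W) (fun u => ?_) hm hm' u
  have hA : (matA (stabilizerEquivK21.symm u)).det ≠ 0 := (Matrix.UnitaryGroup.det_isUnit (stabilizerEquivK21.symm u).1).ne_zero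
  have hd : sclD (stabilizerEquivK21.symm u) ≠ 0 := fun h => by
    have h1 : star (sclD (stabilizerEquivK21.symm u)) * sclD (stabilizerEquivK21.symm u) = 1 :=
      Unitary.coe_star_mul_self (stabilizerEquivK21.symm u).2
    rw [h, mul_zero] at h1
    exact zero_ne_one h1
  rw [lineScalar_zero_stabilizer, hη u, ← zpow_add₀ (mul_ne_zero hA hd), mul_zpow]

end ArchSideTerm

end HodgeCM.Model

end
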